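import Mathlib
import Summits.Ventures.PercRepro2.SwOutMultiRootDefs

/-!
# The multi-root core cube WITH ROOT–ROOT EDGES: the base and the avoidance lemmas (blind cell
PercRepro2, night-4 g34, 2026-08-29; proofs/NIGHT4-G34.md §8)

SwOutMultiRootDefs forbids edges between two roots (g29 subdivides them).  Here an edge joining two
roots is a CUBE COORDINATE OF ITS OWN: the cube points are `Config (ι ⊕ ↥RR)` — a colour per arm and
a colour per root–root edge — and the realisation `coreRealRR` flips the arms assigned `false` and
negates the root–root edges assigned `false` of a base in which every edge at a root is red.
`MultiBaseE` is `MultiBase` with `root_edges` weakened to «an edge at a root goes into an arm or to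
another root» (no loops at roots); the four avoidance lemmas hold verbatim — a red path from a root
moves between roots along red root–root edges and visits `true` arms only; a path from outside
never reaches a root.  Every junction of a mark-step class is then a root whatever its edges to `h`
and to the other junctions (adjacent junctions, several edges to `h`), with no subdivision.
-/

namespace Summit.Ventures.PercRepro2

namespace LocRows

open Hull

variable {V : Type*} {E : Type*}

open scoped Classical

variable {ends : E → Sym2 V}

/-- **The data of a multi-root core cube with root–root edges**: as `MultiBase`, except that an edge
at a root may lead to another root (`root_edges`), no loop at a root (`loop_root`), and `RR` is the
finite set of the edges joining two roots (`rr_iff`). -/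
structure MultiBaseE (ends : E → Sym2 V) (ζ : Config E) (R : Set V) (H : Set V) {ι : Type*}
    (A : ι → Set V) (RR : Finset E) : Prop where
  root_sub : R ⊆ H
  bdry_blue : ∀ e x y, ends e = s(x, y) → x ∈ H → y ∉ H → ζ e = false
  arm_sub : ∀ i, ∀ x ∈ A i, x ∈ H ∧ x ∉ R
  arm_nonempty : ∀ i, (A i).Nonempty
  arm_disj : ∀ i j, i ≠ j → ∀ x, x ∈ A i → x ∉ A j
  arm_cover : ∀ x ∈ H, x ∉ R → ∃ i, x ∈ A i
  no_cross : ∀ i j, i ≠ j → ∀ e x y, ends e = s(x, y) → x ∈ A i → y ∈ A j → False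
  root_edges : ∀ e r x, r ∈ R → ends e = s(r, x) → x ∈ R ∨ ∃ i, x ∈ A i
  loop_root : ∀ e r, r ∈ R → ends e ≠ s(r, r)
  root_red : ∀ e r x, r ∈ R → ends e = s(r, x) → ζ e = true
  rr_iff : ∀ e, e ∈ RR ↔ ∃ r ∈ R, ∃ r' ∈ R, ends e = s(r, r')
  conn : ∀ i, ∀ x ∈ A i, ∃ r ∈ R, x ∈ cluster ends (insideConfig ends (A i ∪ {r}) ζ) r

section Real

variable {ι : Type*} (A : ι → Set V) (RR : Finset E)

variable (ends) in
/-- The realisation of a cube point: the arms assigned `false` flipped, the root–root edges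
assigned `false` negated. -/
noncomputable def coreRealRR (ζ : Config E) (ω : Config (ι ⊕ ↥RR)) : Config E :=
  fun e => if he : e ∈ RR then (if ω (Sum.inr ⟨e, he⟩) = true then ζ e else !ζ e)
    else coreReal ends A ζ (fun i => ω (Sum.inl i)) e

variable {A RR}

/-- The realisation on a root–root edge. -/
lemma coreRealRR_apply_rr {ζ : Config E} {ω : Config (ι ⊕ ↥RR)} {e : E} (he : e ∈ RR) :
    coreRealRR ends A RR ζ ω e = (if ω (Sum.inr ⟨e, he⟩) = true then ζ e else !ζ e) := by
  simp only [coreRealRR, dif_pos he]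

/-- The realisation off the root–root edges is g13's realisation of the arm part. -/
lemma coreRealRR_apply_of_notMem_rr {ζ : Config E} {ω : Config (ι ⊕ ↥RR)} {e : E} (he : e ∉ RR) :
    coreRealRR ends A RR ζ ω e = coreReal ends A ζ (fun i => ω (Sum.inl i)) e := by
  simp only [coreRealRR, dif_neg he]

end Real

section Base

variable {ι : Type*} {A : ι → Set V} {ζ : Config E} {R H : Set V} {RR : Finset E}
  (hb : MultiBaseE ends ζ R H A RR)
include hb

/-- A root lies in no arm. -/
lemma MultiBaseE.root_notMem_arm {r : V} (hr : r ∈ R) (i : ι) : r ∉ A i :=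
  fun h' => (hb.arm_sub i r h').2 hr

/-- An edge with an end in an arm is not a root–root edge. -/
lemma MultiBaseE.notMem_rr_of_mem_arm {e : E} {x y : V} (hxy : ends e = s(x, y)) {i : ι}
    (hx : x ∈ A i) : e ∉ RR := by
  intro he
  obtain ⟨r, hr, r', hr', hrr⟩ := (hb.rr_iff e).1 he
  rw [hxy, Sym2.eq_iff] at hrr
  rcases hrr with ⟨rfl, -⟩ | ⟨rfl, -⟩
  · exact hb.root_notMem_arm hr i hx
  · exact hb.root_notMem_arm hr' i hx

/-- An edge joining two roots is a root–root edge. -/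
lemma MultiBaseE.mem_rr {e : E} {r r' : V} (hr : r ∈ R) (hr' : r' ∈ R) (hrr : ends e = s(r, r')) :
    e ∈ RR := (hb.rr_iff e).2 ⟨r, hr, r', hr', hrr⟩

/-- The two ends of an edge in arms lie in the same arm. -/
lemma MultiBaseE.arm_eq_of_edge {i j : ι} {e : E} {x y : V} (hxy : ends e = s(x, y)) (hx : x ∈ A i)
    (hy : y ∈ A j) : i = j := by
  by_contra hij
  exact hb.no_cross i j hij e x y hxy hx hy

/-- An edge with an end in `A i` touches the arms assigned `false` iff `ω i = false`. -/
lemma MultiBaseE.touches_armsFalseC_iff {ω : Config ι} {i : ι} {e : E} {x y : V}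
    (hxy : ends e = s(x, y)) (hx : x ∈ A i) :
    e ∈ touches ends (armsFalseC A ω) ↔ ω i = false := by
  constructor
  · rintro ⟨z, ⟨j, hj, hz⟩, w, hzw⟩
    rw [hxy, Sym2.eq_iff] at hzw
    rcases hzw with ⟨h1, _⟩ | ⟨_, h2⟩
    · rw [← h1] at hz
      have hji : j = i := by
        by_contra hne
        exact hb.arm_disj j i hne x hz hx
      rw [← hji]; exact hj
    · rw [← h2] at hz
      have hij : i = j := hb.arm_eq_of_edge hxy hx hz
      rw [hij]; exact hj
  · intro hi
    exact ⟨x, ⟨i, hi, hx⟩, y, hxy⟩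

/-- The value of a realisation on an edge with an end in `A i`. -/
lemma MultiBaseE.coreRealRR_apply_of_mem {ω : Config (ι ⊕ ↥RR)} {i : ι} {e : E} {x y : V}
    (hxy : ends e = s(x, y)) (hx : x ∈ A i) :
    coreRealRR ends A RR ζ ω e = (if ω (Sum.inl i) = true then ζ e else !ζ e) := by
  rw [coreRealRR_apply_of_notMem_rr (hb.notMem_rr_of_mem_arm hxy hx)]
  unfold coreReal
  by_cases hi : ω (Sum.inl i) = true
  · rw [flip_apply_of_notMem, if_pos hi]
    rw [hb.touches_armsFalseC_iff hxy hx]; simp [hi]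
  · rw [flip_apply_of_mem, if_neg hi]
    rw [hb.touches_armsFalseC_iff hxy hx]
    simpa using hi

omit hb in
/-- The value of a realisation on an edge with no end in an arm and not joining two roots. -/
lemma MultiBaseE.coreRealRR_apply_of_notMem {ω : Config (ι ⊕ ↥RR)} {e : E}
    (he : e ∉ touches ends (allArms A)) (hrr : e ∉ RR) : coreRealRR ends A RR ζ ω e = ζ e := by
  rw [coreRealRR_apply_of_notMem_rr hrr]
  unfold coreReal
  rw [flip_apply_of_notMem]
  exact fun h' => he (touches_mono (armsFalseC_subset_allArms _) h')

/-- An edge at a root with its other end in `A i` is red at a cube point iff `ω (inl i) = true`. -/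
lemma MultiBaseE.coreRealRR_root_edge {ω : Config (ι ⊕ ↥RR)} {i : ι} {e : E} {r x : V} (hr : r ∈ R)
    (hrx : ends e = s(r, x)) (hx : x ∈ A i) :
    coreRealRR ends A RR ζ ω e = true ↔ ω (Sum.inl i) = true := by
  rw [hb.coreRealRR_apply_of_mem (ends_swap hrx) hx, hb.root_red e r x hr hrx]
  by_cases hi : ω (Sum.inl i) = true <;> simp [hi]

/-- A root–root edge is red at a cube point iff its coordinate is `true`. -/
lemma MultiBaseE.coreRealRR_rr_edge {ω : Config (ι ⊕ ↥RR)} {e : E} (he : e ∈ RR) :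
    coreRealRR ends A RR ζ ω e = true ↔ ω (Sum.inr ⟨e, he⟩) = true := by
  obtain ⟨r, hr, r', hr', hrr⟩ := (hb.rr_iff e).1 he
  rw [coreRealRR_apply_rr he, hb.root_red e r r' hr hrr]
  by_cases hi : ω (Sum.inr ⟨e, he⟩) = true <;> simp [hi]

/-- An edge from `A i` to the outside of `H` is red at a cube point iff `ω (inl i) = false`. -/
lemma MultiBaseE.coreRealRR_out_edge {ω : Config (ι ⊕ ↥RR)} {i : ι} {e : E} {x y : V}
    (hxy : ends e = s(x, y)) (hx : x ∈ A i) (hy : y ∉ H) :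
    coreRealRR ends A RR ζ ω e = true ↔ ω (Sum.inl i) = false := by
  rw [hb.coreRealRR_apply_of_mem hxy hx, hb.bdry_blue e x y hxy (hb.arm_sub i x hx).1 hy]
  by_cases hi : ω (Sum.inl i) = true <;> simp [hi]

/-- A vertex adjacent to a root is a root or lies in an arm (in particular in `H`). -/
lemma MultiBaseE.mem_H_of_adj_root {e : E} {r x : V} (hr : r ∈ R) (hrx : ends e = s(r, x)) :
    x ∈ H := by
  rcases hb.root_edges e r x hr hrx with h' | ⟨i, hi⟩
  · exact hb.root_sub h'
  · exact (hb.arm_sub i x hi).1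

/-! ### The four avoidance lemmas -/

/-- The arm part of a cube point. -/
abbrev armPart {ι : Type*} {RR : Finset E} (ω : Config (ι ⊕ ↥RR)) : Config ι :=
  fun i => ω (Sum.inl i)

/-- **Red paths from a root visit roots and `true` arms only.** -/
lemma MultiBaseE.red_closed (ω : Config (ι ⊕ ↥RR)) {x y : V}
    (hx : x ∈ R ∪ armsTrueC A (armPart ω))
    (hxy : (openGraph ends (coreRealRR ends A RR ζ ω)).Adj x y) :
    y ∈ R ∪ armsTrueC A (armPart ω) := by
  obtain ⟨_, e, he, hxy⟩ := exists_edge_of_adj hxy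
  rcases hx with hx | ⟨i, hi, hx⟩
  · rcases hb.root_edges e x y hx hxy with hy | ⟨j, hy⟩
    · exact Or.inl hy
    · have := (hb.coreRealRR_root_edge hx hxy hy).1 he
      exact Or.inr ⟨j, this, hy⟩
  · by_cases hyR : y ∈ R
    · exact Or.inl hyR
    by_cases hyH : y ∈ H
    · obtain ⟨j, hy⟩ := hb.arm_cover y hyH hyR
      have hij := hb.arm_eq_of_edge hxy hx hy
      subst hij
      exact Or.inr ⟨i, hi, hy⟩
    · exfalso
      have := (hb.coreRealRR_out_edge hxy hx hyH).1 he
      simp [hi] at this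

/-- **Blue paths from a root visit roots and `false` arms only.** -/
lemma MultiBaseE.blue_closed (ω : Config (ι ⊕ ↥RR)) {x y : V}
    (hx : x ∈ R ∪ armsFalseC A (armPart ω))
    (hxy : (openGraph ends (blue (coreRealRR ends A RR ζ ω))).Adj x y) :
    y ∈ R ∪ armsFalseC A (armPart ω) := by
  obtain ⟨_, e, he, hxy⟩ := exists_edge_of_adj hxy
  rw [blue_eq_true_iff] at he
  rcases hx with hx | ⟨i, hi, hx⟩
  · rcases hb.root_edges e x y hx hxy with hy | ⟨j, hy⟩
    · exact Or.inl hy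
    · have := hb.coreRealRR_root_edge (ω := ω) hx hxy hy
      refine Or.inr ⟨j, ?_, hy⟩
      by_contra hj
      rw [Bool.not_eq_false] at hj
      rw [this.2 hj] at he; simp at he
  · by_cases hyR : y ∈ R
    · exact Or.inl hyR
    by_cases hyH : y ∈ H
    · obtain ⟨j, hy⟩ := hb.arm_cover y hyH hyR
      have hij := hb.arm_eq_of_edge hxy hx hy
      subst hij
      exact Or.inr ⟨i, hi, hy⟩
    · exfalso
      have := hb.coreRealRR_out_edge (ω := ω) hxy hx hyH
      rw [this.2 hi] at he; simp at he

/-- **Red paths from the outside visit outside vertices and `false` arms only** (never a root). -/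
lemma MultiBaseE.red_closed_out (ω : Config (ι ⊕ ↥RR)) {x y : V}
    (hx : x ∈ Hᶜ ∪ armsFalseC A (armPart ω))
    (hxy : (openGraph ends (coreRealRR ends A RR ζ ω)).Adj x y) :
    y ∈ Hᶜ ∪ armsFalseC A (armPart ω) := by
  obtain ⟨_, e, he, hxy⟩ := exists_edge_of_adj hxy
  rcases hx with hx | ⟨i, hi, hx⟩
  · by_cases hyH : y ∈ H
    · by_cases hyR : y ∈ R
      · exact absurd (hb.mem_H_of_adj_root hyR (ends_swap hxy)) hx
      · obtain ⟨j, hy⟩ := hb.arm_cover y hyH hyR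
        have := (hb.coreRealRR_out_edge (ends_swap hxy) hy hx).1 he
        exact Or.inr ⟨j, this, hy⟩
    · exact Or.inl hyH
  · by_cases hyH : y ∈ H
    · by_cases hyR : y ∈ R
      · exfalso
        have := (hb.coreRealRR_root_edge hyR (ends_swap hxy) hx).1 he
        simp [hi] at this
      · obtain ⟨j, hy⟩ := hb.arm_cover y hyH hyR
        have hij := hb.arm_eq_of_edge hxy hx hy
        subst hij
        exact Or.inr ⟨i, hi, hy⟩
    · exact Or.inl hyH

/-- **Blue paths from the outside visit outside vertices and `true` arms only** (never a root). -/
lemma MultiBaseE.blue_closed_out (ω : Config (ι ⊕ ↥RR)) {x y : V}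
    (hx : x ∈ Hᶜ ∪ armsTrueC A (armPart ω))
    (hxy : (openGraph ends (blue (coreRealRR ends A RR ζ ω))).Adj x y) :
    y ∈ Hᶜ ∪ armsTrueC A (armPart ω) := by
  obtain ⟨_, e, he, hxy⟩ := exists_edge_of_adj hxy
  rw [blue_eq_true_iff] at he
  rcases hx with hx | ⟨i, hi, hx⟩
  · by_cases hyH : y ∈ H
    · by_cases hyR : y ∈ R
      · exact absurd (hb.mem_H_of_adj_root hyR (ends_swap hxy)) hx
      · obtain ⟨j, hy⟩ := hb.arm_cover y hyH hyR
        have := hb.coreRealRR_out_edge (ω := ω) (ends_swap hxy) hy hx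
        refine Or.inr ⟨j, ?_, hy⟩
        by_contra hj
        rw [Bool.not_eq_true] at hj
        rw [this.2 hj] at he; simp at he
    · exact Or.inl hyH
  · by_cases hyH : y ∈ H
    · by_cases hyR : y ∈ R
      · exfalso
        have := hb.coreRealRR_root_edge (ω := ω) hyR (ends_swap hxy) hx
        rw [this.2 hi] at he; simp at he
      · obtain ⟨j, hy⟩ := hb.arm_cover y hyH hyR
        have hij := hb.arm_eq_of_edge hxy hx hy
        subst hij
        exact Or.inr ⟨i, hi, hy⟩
    · exact Or.inl hyH

/-- A vertex of the red cluster of a root at a cube point is a root or lies in a `true` arm. -/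
theorem MultiBaseE.mem_root_or_true_of_mem_cluster (ω : Config (ι ⊕ ↥RR)) {r x : V} (hr : r ∈ R)
    (hx : x ∈ cluster ends (coreRealRR ends A RR ζ ω) r) :
    x ∈ R ∨ ∃ i, armPart ω i = true ∧ x ∈ A i :=
  mem_of_conn_of_closed (S := R ∪ armsTrueC A (armPart ω))
    (fun _ hx' _ hxy => hb.red_closed ω hx' hxy) (Or.inl hr) hx

/-- A vertex of the blue cluster of a root at a cube point is a root or lies in a `false` arm. -/
theorem MultiBaseE.mem_root_or_false_of_mem_cluster_blue (ω : Config (ι ⊕ ↥RR)) {r x : V}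
    (hr : r ∈ R) (hx : x ∈ cluster ends (blue (coreRealRR ends A RR ζ ω)) r) :
    x ∈ R ∨ ∃ i, armPart ω i = false ∧ x ∈ A i :=
  mem_of_conn_of_closed (S := R ∪ armsFalseC A (armPart ω))
    (fun _ hx' _ hxy => hb.blue_closed ω hx' hxy) (Or.inl hr) hx

/-- A vertex of the red cluster of an outside vertex at a cube point is outside `H` or lies in a
`false` arm (never a root). -/
theorem MultiBaseE.mem_notMem_or_false_of_mem_cluster_out (ω : Config (ι ⊕ ↥RR)) {y x : V}
    (hy : y ∉ H) (hx : x ∈ cluster ends (coreRealRR ends A RR ζ ω) y) :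
    x ∉ H ∨ ∃ i, armPart ω i = false ∧ x ∈ A i :=
  mem_of_conn_of_closed (S := Hᶜ ∪ armsFalseC A (armPart ω))
    (fun _ hx' _ hxy => hb.red_closed_out ω hx' hxy) (Or.inl hy) hx

/-- A vertex of the blue cluster of an outside vertex at a cube point is outside `H` or lies in a
`true` arm (never a root). -/
theorem MultiBaseE.mem_notMem_or_true_of_mem_cluster_blue_out (ω : Config (ι ⊕ ↥RR)) {y x : V}
    (hy : y ∉ H) (hx : x ∈ cluster ends (blue (coreRealRR ends A RR ζ ω)) y) :
    x ∉ H ∨ ∃ i, armPart ω i = true ∧ x ∈ A i :=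
  mem_of_conn_of_closed (S := Hᶜ ∪ armsTrueC A (armPart ω))
    (fun _ hx' _ hxy => hb.blue_closed_out ω hx' hxy) (Or.inl hy) hx

/-- A root is in neither cluster of an outside vertex at a cube point. -/
theorem MultiBaseE.root_notMem_cluster_out (ω : Config (ι ⊕ ↥RR)) {y r : V} (hy : y ∉ H)
    (hr : r ∈ R) :
    r ∉ cluster ends (coreRealRR ends A RR ζ ω) y ∧
      r ∉ cluster ends (blue (coreRealRR ends A RR ζ ω)) y := by
  constructor
  · intro hr'
    rcases hb.mem_notMem_or_false_of_mem_cluster_out ω hy hr' with h' | ⟨i, _, hi⟩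
    · exact h' (hb.root_sub hr)
    · exact hb.root_notMem_arm hr i hi
  · intro hr'
    rcases hb.mem_notMem_or_true_of_mem_cluster_blue_out ω hy hr' with h' | ⟨i, _, hi⟩
    · exact h' (hb.root_sub hr)
    · exact hb.root_notMem_arm hr i hi

/-- The hull of a root at a cube point lies inside `H`. -/
theorem MultiBaseE.hull_subset (ω : Config (ι ⊕ ↥RR)) {r : V} (hr : r ∈ R) :
    hull ends (coreRealRR ends A RR ζ ω) r ⊆ H := by
  rintro x (hx | hx)
  · rcases hb.mem_root_or_true_of_mem_cluster ω hr hx with h' | ⟨i, _, hi⟩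
    · exact hb.root_sub h'
    · exact (hb.arm_sub i x hi).1
  · rcases hb.mem_root_or_false_of_mem_cluster_blue ω hr hx with h' | ⟨i, _, hi⟩
    · exact hb.root_sub h'
    · exact (hb.arm_sub i x hi).1

end Base

end LocRows

end Summit.Ventures.PercRepro2
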